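import Summits.Ventures.PercRepro2.Harris

/-!
# Splitting the product law along a set of edges
(blind cell PercRepro2, p1 g27; the measure-side tool of the pocket reduction)

For a finite set `P` of edges the product law factors into its `P`-part and its complement:
`outW P p` carries the weights of `p` off `P` and pins the edges of `P` closed, `inW P p` does the
opposite; `merge P ω₂ ω₁` takes the `P`-states from `ω₂` and the others from `ω₁`. **`expect_split`**:
`E_p[g] = E_{outW}[ω₁ ↦ E_{inW}[ω₂ ↦ g (merge P ω₂ ω₁)]]` — an exploration of the edges of `P`
independently of the rest, in the finite-sum vocabulary of `Defs.lean` (the same kind of statement as the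
one-edge pinning `expect_eq_update_pin`, for a whole edge set at once). `expect_outW_outOnly` says that
under `outW P p` the observable may be read on the configuration with `P` closed, and
`expect_bool_split` splits an expectation along a Boolean observable. Own code; standard axioms. -/

namespace Summit.Ventures.PercRepro2

namespace CaseOne

section SplitDefs
variable {E : Type*} [DecidableEq E] {R : Type*} [CommRing R]

/-- The weights of `p` off `P`, the edges of `P` pinned closed. -/
def outW (P : Finset E) (p : E → R) : E → R := fun e => if e ∈ P then 0 else p e

/-- The weights of `p` on `P`, the edges off `P` pinned closed. -/
def inW (P : Finset E) (p : E → R) : E → R := fun e => if e ∈ P then p e else 0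

/-- The configuration `ω` with the edges of `P` closed. -/
def outOnly (P : Finset E) (ω : Config E) : Config E := fun e => if e ∈ P then false else ω e

/-- The configuration `ω` with the edges off `P` closed. -/
def inOnly (P : Finset E) (ω : Config E) : Config E := fun e => if e ∈ P then ω e else false

/-- The `P`-states from `ω₂`, the others from `ω₁`. -/
def merge (P : Finset E) (ω₂ ω₁ : Config E) : Config E := fun e => if e ∈ P then ω₂ e else ω₁ e

variable (P : Finset E)

/-- The outside weight on `P` is `0`. -/
@[simp] lemma outW_of_mem (p : E → R) {e : E} (he : e ∈ P) : outW P p e = 0 := by simp [outW, he]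

/-- The outside weight off `P` is `p`. -/
@[simp] lemma outW_of_not_mem (p : E → R) {e : E} (he : e ∉ P) : outW P p e = p e := by
  simp [outW, he]

/-- The `P`-weight on `P` is `p`. -/
@[simp] lemma inW_of_mem (p : E → R) {e : E} (he : e ∈ P) : inW P p e = p e := by simp [inW, he]

/-- The `P`-weight off `P` is `0`. -/
@[simp] lemma inW_of_not_mem (p : E → R) {e : E} (he : e ∉ P) : inW P p e = 0 := by simp [inW, he]

/-- The outside part is closed on `P`. -/
@[simp] lemma outOnly_of_mem (ω : Config E) {e : E} (he : e ∈ P) : outOnly P ω e = false := by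
  simp [outOnly, he]

/-- The outside part agrees with `ω` off `P`. -/
@[simp] lemma outOnly_of_not_mem (ω : Config E) {e : E} (he : e ∉ P) : outOnly P ω e = ω e := by
  simp [outOnly, he]

/-- The `P`-part agrees with `ω` on `P`. -/
@[simp] lemma inOnly_of_mem (ω : Config E) {e : E} (he : e ∈ P) : inOnly P ω e = ω e := by
  simp [inOnly, he]

/-- The `P`-part is closed off `P`. -/
@[simp] lemma inOnly_of_not_mem (ω : Config E) {e : E} (he : e ∉ P) : inOnly P ω e = false := by
  simp [inOnly, he]

/-- Merging the two parts of `ω` gives back `ω`. -/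
lemma merge_inOnly_outOnly (ω : Config E) : merge P (inOnly P ω) (outOnly P ω) = ω := by
  funext e
  by_cases he : e ∈ P <;> simp [merge, inOnly, outOnly, he]

/-- The outside part of a merge is the outside part of the outside argument. -/
lemma outOnly_merge (ω₂ ω₁ : Config E) : outOnly P (merge P ω₂ ω₁) = outOnly P ω₁ := by
  funext e
  by_cases he : e ∈ P <;> simp [merge, outOnly, he]

/-- The `P`-part of a merge is the `P`-part of the `P`-argument. -/
lemma inOnly_merge (ω₂ ω₁ : Config E) : inOnly P (merge P ω₂ ω₁) = inOnly P ω₂ := by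
  funext e
  by_cases he : e ∈ P <;> simp [merge, inOnly, he]

/-- A configuration closed on `P` is its own outside part. -/
lemma outOnly_eq_self {ω : Config E} (h : ∀ e ∈ P, ω e = false) : outOnly P ω = ω := by
  funext e
  by_cases he : e ∈ P
  · simp [outOnly, he, h e he]
  · simp [outOnly, he]

/-- A configuration closed off `P` is its own `P`-part. -/
lemma inOnly_eq_self {ω : Config E} (h : ∀ e, e ∉ P → ω e = false) : inOnly P ω = ω := by
  funext e
  by_cases he : e ∈ P
  · simp [inOnly, he]
  · simp [inOnly, he, h e he]

/-- The outside part is closed on `P`. -/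
lemma outOnly_closed (ω : Config E) : ∀ e ∈ P, outOnly P ω e = false := fun e he => by simp [he]

/-- The `P`-part is closed off `P`. -/
lemma inOnly_closed (ω : Config E) : ∀ e, e ∉ P → inOnly P ω e = false := fun e he => by simp [he]

/-- The outside part is below the configuration. -/
lemma outOnly_le (ω : Config E) : outOnly P ω ≤ ω := by
  intro e
  by_cases he : e ∈ P
  · simp [he]
  · simp [he]

/-- The `P`-part is below the configuration. -/
lemma inOnly_le (ω : Config E) : inOnly P ω ≤ ω := by
  intro e
  by_cases he : e ∈ P
  · simp [he]
  · simp [he]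

end SplitDefs

section SplitMeasure
variable {E : Type*} [Fintype E] [DecidableEq E] {R : Type*} [CommRing R] (P : Finset E)

/-- **The product weight factors** into the outside weight of the outside part and the `P`-weight of the
`P`-part. -/
lemma weight_outW_mul_weight_inW (p : E → R) (ω : Config E) :
    weight (outW P p) (outOnly P ω) * weight (inW P p) (inOnly P ω) = weight p ω := by
  unfold weight
  rw [← Finset.prod_mul_distrib]
  refine Finset.prod_congr rfl fun e _ => ?_
  by_cases he : e ∈ P <;> simp [he]

/-- Under the outside weights a configuration with an open edge of `P` has weight zero. -/
lemma weight_outW_eq_zero (p : E → R) {ω : Config E} {e : E} (he : e ∈ P) (hω : ω e = true) :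
    weight (outW P p) ω = 0 := by
  unfold weight
  exact Finset.prod_eq_zero (Finset.mem_univ e) (by simp [he, hω])

/-- Under the `P`-weights a configuration with an open edge off `P` has weight zero. -/
lemma weight_inW_eq_zero (p : E → R) {ω : Config E} {e : E} (he : e ∉ P) (hω : ω e = true) :
    weight (inW P p) ω = 0 := by
  unfold weight
  exact Finset.prod_eq_zero (Finset.mem_univ e) (by simp [he, hω])

/-- Under the outside weights an observable may be read on the outside part. -/
theorem expect_outW_outOnly (p : E → R) (F : Config E → R) :
    expect (outW P p) F = expect (outW P p) (fun ω => F (outOnly P ω)) := by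
  unfold expect
  refine Finset.sum_congr rfl fun ω _ => ?_
  by_cases h : ∀ e ∈ P, ω e = false
  · dsimp only
    rw [outOnly_eq_self P h]
  · push Not at h
    obtain ⟨e, he, hω⟩ := h
    rw [weight_outW_eq_zero P p he (by simpa using hω)]
    simp

/-- Under the `P`-weights an observable may be read on the `P`-part. -/
theorem expect_inW_inOnly (p : E → R) (F : Config E → R) :
    expect (inW P p) F = expect (inW P p) (fun ω => F (inOnly P ω)) := by
  unfold expect
  refine Finset.sum_congr rfl fun ω _ => ?_
  by_cases h : ∀ e, e ∉ P → ω e = false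
  · dsimp only
    rw [inOnly_eq_self P h]
  · push Not at h
    obtain ⟨e, he, hω⟩ := h
    rw [weight_inW_eq_zero P p he (by simpa using hω)]
    simp

/-- **The product law splits along `P`**: explore the edges of `P` independently of the rest. -/
theorem expect_split (p : E → R) (g : Config E → R) :
    expect p g =
      expect (outW P p) (fun ω₁ => expect (inW P p) (fun ω₂ => g (merge P ω₂ ω₁))) := by
  -- the support of the double sum
  set S : Finset (Config E × Config E) :=
    (Finset.univ ×ˢ Finset.univ).filter
      (fun pr => (∀ e ∈ P, pr.1 e = false) ∧ ∀ e, e ∉ P → pr.2 e = false) with hS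
  have hsum : expect (outW P p) (fun ω₁ => expect (inW P p) (fun ω₂ => g (merge P ω₂ ω₁))) =
      ∑ pr ∈ Finset.univ ×ˢ Finset.univ,
        weight (outW P p) pr.1 * (weight (inW P p) pr.2 * g (merge P pr.2 pr.1)) := by
    unfold expect
    dsimp only
    simp only [Finset.mul_sum]
    exact (Finset.sum_product' (s := Finset.univ) (t := Finset.univ)
      (fun a b => weight (outW P p) a * (weight (inW P p) b * g (merge P b a)))).symm
  rw [hsum]
  -- restrict to the support
  have hsub : S ⊆ Finset.univ ×ˢ Finset.univ := Finset.filter_subset _ _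
  rw [← Finset.sum_subset hsub]
  · -- the bijection between `Config E` and the support
    unfold expect
    refine Finset.sum_nbij' (fun ω => (outOnly P ω, inOnly P ω)) (fun pr => merge P pr.2 pr.1)
      ?_ ?_ ?_ ?_ ?_
    · intro ω _
      simp only [hS, Finset.mem_filter, Finset.mem_product, Finset.mem_univ, true_and]
      exact ⟨outOnly_closed P ω, inOnly_closed P ω⟩
    · intro pr _
      exact Finset.mem_univ _
    · intro ω _
      exact merge_inOnly_outOnly P ω
    · intro pr hpr
      simp only [hS, Finset.mem_filter, Finset.mem_product, Finset.mem_univ, true_and] at hpr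
      rw [outOnly_merge, inOnly_merge, outOnly_eq_self P hpr.1, inOnly_eq_self P hpr.2]
    · intro ω _
      rw [merge_inOnly_outOnly, ← mul_assoc, weight_outW_mul_weight_inW]
  · intro pr _ hpr
    simp only [hS, Finset.mem_filter, Finset.mem_product, Finset.mem_univ, true_and,
      not_and_or] at hpr
    rcases hpr with h | h
    · push Not at h
      obtain ⟨e, he, hω⟩ := h
      rw [weight_outW_eq_zero P p he (by simpa using hω), zero_mul]
    · push Not at h
      obtain ⟨e, he, hω⟩ := h
      rw [weight_inW_eq_zero P p he (by simpa using hω), zero_mul, mul_zero]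

/-- An expectation split along a Boolean observable `h`: `E[G ∘ h] = G true · P(h) + G false · (1 − P(h))`. -/
theorem expect_bool_split (q : E → R) (h : Config E → Bool) (G : Bool → R) :
    expect q (fun ω => G (h ω)) =
      G true * prob q {ω | h ω = true} + G false * (1 - prob q {ω | h ω = true}) := by
  have hfun : (fun ω => G (h ω)) =
      (fun ω => G true * ({ω | h ω = true} : Set (Config E)).indicator 1 ω) +
        (fun ω => G false * ({ω | h ω = true} : Set (Config E))ᶜ.indicator 1 ω) := by
    funext ω
    by_cases hω : h ω = true
    · simp [hω]
    · have hω' : h ω = false := by simpa using hω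
      simp [hω']
  rw [hfun, expect_add, expect_const_mul, expect_const_mul, ← prob_eq_expect_indicator,
    ← prob_eq_expect_indicator, prob_compl]

end SplitMeasure

section SplitOrder
variable {E : Type*} [DecidableEq E] {R : Type*} [CommRing R] [PartialOrder R]
  [IsOrderedRing R] (P : Finset E)

/-- The outside weights of a probability vector form a probability vector. -/
lemma IsProbVec.outW {p : E → R} (hp : IsProbVec p) : IsProbVec (CaseOne.outW P p) := by
  refine ⟨fun e => ?_, fun e => ?_⟩
  · by_cases he : e ∈ P
    · simp [he]
    · simp [he, hp.nonneg e]
  · by_cases he : e ∈ P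
    · simp [he]
    · simp [he, hp.le_one e]

/-- The `P`-weights of a probability vector form a probability vector. -/
lemma IsProbVec.inW {p : E → R} (hp : IsProbVec p) : IsProbVec (CaseOne.inW P p) := by
  refine ⟨fun e => ?_, fun e => ?_⟩
  · by_cases he : e ∈ P
    · simp [he, hp.nonneg e]
    · simp [he]
  · by_cases he : e ∈ P
    · simp [he, hp.le_one e]
    · simp [he]

end SplitOrder

end CaseOne

end Summit.Ventures.PercRepro2
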